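import Mathlib
import HarnessLib
import Summits.NavierStokesRegularity.NavierStokesRegularity.Theorems.PoloidalWindowDoorLrcModEntireRidgeGlobalBranchUnique

/-!
# Item `LrcModEntire` (stmt-NavierStokesRegularity-20428) — BRANCH-PARAM, part 8: every complete non-degenerate hot branch is a PROPERLY EMBEDDED LINE

LEAD of item 20428 ns-poloidal-K2-p3 g15 (`--supports stmt-NavierStokesRegularity-20428 --as helper`).  Class-free global topology of hot branches (memo T2B-g15 §15c, input (G1)
of the research cell (Q4)): with the clause «no compact isolated hot piece» of `stub_T2b` (here: no compact `K ⊆ H` with an open `O ⊇ K`, `O ∩ H ⊆ K`), every `C²` unit-speed curve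
`γ : ℝ → H` into the non-degenerate (`κ ≠ 0`) critical hot set `H = {y₂ = 0, f = M}` of an analytic `f` with bounded `D², D³, D⁴` is

* `goodCurve_injective` — INJECTIVE: two visits of one point give, by ODE uniqueness (`…Unique.hasDerivAt_goodCurve` + `…ODE.eqOn_of_solutions`; the kernel of the Hessian at a hot
  point is the line `ℝγ′`), either a period — then the trace is a compact hot piece, isolated by the local uniqueness `…Unique.hotSet_subset_curve` — or a reversal `γ(c − t) = γ(t)`,
  impossible at `t = c/2` for a unit-speed curve;
* `tendsto_norm_goodCurve_atTop` / `…_atBot` — PROPER: `‖γ s‖ → ∞` as `s → ±∞`: an accumulation point `q = lim γ(s_k)` of the forward end carries a good state `(q, e)`; the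
  local good solution through it (`…Local.exists_local_good_solution`) contains every nearby hot point (`hotSet_subset_curve`), so `γ(s_k + τ_k) = q` for `|τ_k| < ε₀` and
  infinitely many far-apart `s_k` — contradicting injectivity.

WHAT THIS IS NOT: not a claim about Navier–Stokes regularity — topology of the hypothetical ridge of cell (Q4) (bears_on LADDER-NS N0, item 20428 / crux 19708; OPEN).
-/

noncomputable section

set_option linter.style.longLine false
-- the summit and its single sub-problem share the name (CONVENTIONS §1), as in every Theorems file
set_option linter.dupNamespace false

namespace Summit.NavierStokesRegularity.NavierStokesRegularity.Theorems.PoloidalWindowDoorLrcModEntireRidgeGlobalBranchProper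

open Set Filter Topology Metric Function
open scoped NNReal InnerProductSpace RealInnerProductSpace ContDiff
open Summit.NavierStokesRegularity.NavierStokesRegularity.Theorems.PoloidalWindowDoorLrcModEntireRidgeGlobalBranchODE
open Summit.NavierStokesRegularity.NavierStokesRegularity.Theorems.PoloidalWindowDoorLrcModEntireRidgeGlobalBranchFrame
open Summit.NavierStokesRegularity.NavierStokesRegularity.Theorems.PoloidalWindowDoorLrcModEntireRidgeGlobalBranchLocal
open Summit.NavierStokesRegularity.NavierStokesRegularity.Theorems.PoloidalWindowDoorLrcModEntireRidgeGlobalBranchUnique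

variable {f : EuclideanSpace ℝ (Fin 3) → ℝ} {κ M : ℝ}

/-- The kernel of the Hessian at a non-degenerate hot point is a line: two horizontal unit kernel vectors are equal or opposite. -/
theorem kernel_dir_eq_or_eq_neg {B : EuclideanSpace ℝ (Fin 3) →L[ℝ] EuclideanSpace ℝ (Fin 3) →L[ℝ] ℝ} {T T' : EuclideanSpace ℝ (Fin 3)} {κ : ℝ} (hκ : κ ≠ 0)
    (hT2 : T 2 = 0) (hT1 : ‖T‖ = 1) (hT'2 : T' 2 = 0) (hT'1 : ‖T'‖ = 1)
    (hker : ∀ w, B T w = 0) (hker' : ∀ w, B T' w = 0) (htr : B e0 e0 + B e1 e1 = -κ) : T' = T ∨ T' = -T := by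
  obtain ⟨hν2, hν1, hTν, hνT⟩ := rotJ_facts hT2 hT1
  have hνν : B (rotJ T) (rotJ T) = -κ := by
    have hft := frame_trace B hT2 hT1; rw [hker T, htr] at hft; linarith
  have hexp : T' = ⟪T', T⟫ • T + ⟪T', rotJ T⟫ • rotJ T := horiz_expand hT'2 hT2 hT1
  have hc : ⟪T', rotJ T⟫ = 0 := by
    have h := hker' (rotJ T)
    rw [hexp, map_add, map_smul, map_smul, add_apply, smul_apply, smul_apply, hker (rotJ T), hνν, smul_eq_mul, smul_eq_mul, mul_zero, zero_add] at h
    rcases mul_eq_zero.1 h with h | h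
    · exact h
    · exact absurd (neg_eq_zero.1 h) hκ
  rw [hc, zero_smul, add_zero] at hexp
  have hn : |⟪T', T⟫| = 1 := by
    have h := congrArg (fun x : EuclideanSpace ℝ (Fin 3) => ‖x‖) hexp
    simp only [norm_smul, Real.norm_eq_abs, hT1, hT'1, mul_one] at h
    exact h.symm
  rcases abs_eq (zero_le_one) |>.1 hn with h1 | h1
  · left; rw [hexp, h1, one_smul]
  · right; rw [hexp, h1, neg_one_smul]

/-- Reversal: `t ↦ γ(c − t)` of a good `C²` unit-speed hot curve is again one, with derivative `−γ′(c − t)`. -/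
theorem reverse_facts {γ : ℝ → EuclideanSpace ℝ (Fin 3)} (hγ2 : ContDiff ℝ 2 γ) (c : ℝ) :
    ContDiff ℝ 2 (fun t => γ (c - t)) ∧ ∀ t, deriv (fun t => γ (c - t)) t = -deriv γ (c - t) := by
  refine ⟨hγ2.comp ((contDiff_const.sub contDiff_id)), fun t => ?_⟩
  have hγd : HasDerivAt γ (deriv γ (c - t)) (c - t) := ((hγ2.differentiable (by norm_num)) _).hasDerivAt
  have h : HasDerivAt (fun t => γ (c - t)) ((-1 : ℝ) • deriv γ (c - t)) t := hγd.scomp t ((hasDerivAt_id t).const_sub c)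
  rw [h.deriv]; simp

/-- **A complete non-degenerate hot branch is INJECTIVE.**  See the module docstring. -/
theorem goodCurve_injective (hfa : AnalyticOnNhd ℝ f univ) {C₂ C₃ C₄ : ℝ}
    (hC₂ : ∀ x, ‖iteratedFDeriv ℝ 2 f x‖ ≤ C₂) (hC₃ : ∀ x, ‖iteratedFDeriv ℝ 3 f x‖ ≤ C₃) (hC₄ : ∀ x, ‖iteratedFDeriv ℝ 4 f x‖ ≤ C₄)
    (hκ : κ ≠ 0)
    (hcrit : ∀ y : EuclideanSpace ℝ (Fin 3), y 2 = 0 → f y = M → fderiv ℝ f y = 0)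
    (htr : ∀ y : EuclideanSpace ℝ (Fin 3), y 2 = 0 → f y = M → fderiv ℝ (fderiv ℝ f) y e0 e0 + fderiv ℝ (fderiv ℝ f) y e1 e1 = -κ)
    (hiso : ∀ K : Set (EuclideanSpace ℝ (Fin 3)), IsCompact K → K.Nonempty → (∀ y ∈ K, y 2 = 0 ∧ f y = M) →
      ∀ O : Set (EuclideanSpace ℝ (Fin 3)), IsOpen O → K ⊆ O → (∀ y ∈ O, y 2 = 0 → f y = M → y ∈ K) → False)
    {γ : ℝ → EuclideanSpace ℝ (Fin 3)} (hγ2 : ContDiff ℝ 2 γ) (hplane : ∀ s, γ s 2 = 0) (hhot : ∀ s, f (γ s) = M)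
    (hunit : ∀ s, ‖deriv γ s‖ = 1) : Injective γ := by
  have hf : ContDiff ℝ ω f := contDiff_iff_contDiffAt.2 fun x => (hfa x (mem_univ x)).contDiffAt
  have hf2 : ContDiff ℝ 2 f := hf.of_le le_top
  have hf4 : ContDiff ℝ 4 f := hf.of_le le_top
  have hγd : ∀ t, HasDerivAt γ (deriv γ t) t := fun t => ((hγ2.differentiable (by norm_num)) t).hasDerivAt
  have hγ1 : ContDiff ℝ 1 (deriv γ) := by
    have h2 := hγ2; rw [show (2 : WithTop ℕ∞) = 1 + 1 by norm_num, contDiff_succ_iff_deriv] at h2; exact h2.2.2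
  have hu2 : ∀ t, deriv γ t 2 = 0 := fun t => deriv_apply_two_eq_zero (hγd t) hplane
  have hker : ∀ t w, fderiv ℝ (fderiv ℝ f) (γ t) (deriv γ t) w = 0 := fun t w => hessian_apply_deriv_eq_zero_of_hot hf2 hcrit (hγd t) hplane hhot w
  have hZ : ∀ t, HasDerivAt (fun t => (γ t, deriv γ t)) (branchField f κ (γ t, deriv γ t)) t :=
    hasDerivAt_goodCurve hfa hκ hcrit htr hγ2 hplane hhot hunit
  intro s₁ s₂ heq
  by_contra hne
  -- WLOG `s₁ < s₂`
  wlog hlt : s₁ < s₂ generalizing s₁ s₂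
  · exact this heq.symm (Ne.symm hne) (lt_of_le_of_ne (not_lt.1 hlt) (Ne.symm hne))
  -- the two tangents at the common point are equal or opposite
  have hdir := kernel_dir_eq_or_eq_neg (B := fderiv ℝ (fderiv ℝ f) (γ s₁)) hκ (hu2 s₁) (hunit s₁) (hu2 s₂) (hunit s₂)
    (hker s₁) (by rw [heq]; exact hker s₂) (htr _ (hplane s₁) (hhot s₁))
  rcases hdir with hsame | hopp
  · -- ## periodic case: the trace is a compact isolated hot piece
    set p := s₂ - s₁ with hp
    have hp0 : 0 < p := by rw [hp]; linarith
    have hper : Function.Periodic γ p := by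
      intro t
      -- both `u ↦ Z(u)` and `u ↦ Z(u + p)` solve the ODE and agree at `s₁`
      have hsol2 : ∀ u ∈ Ioo (s₁ - (|t - s₁| + 1)) (s₁ + (|t - s₁| + 1)),
          HasDerivAt (fun u => (γ (u + p), deriv γ (u + p))) (branchField f κ (γ (u + p), deriv γ (u + p))) u := fun u _ => by
        have h := hZ (u + p)
        exact h.comp_add_const u p
      have hstart : (γ (s₁ + p), deriv γ (s₁ + p)) = (γ s₁, deriv γ s₁) := by
        rw [show s₁ + p = s₂ by rw [hp]; ring, ← heq, hsame]
      have heqOn := eqOn_of_solutions (κ := κ) hf4 hC₂ hC₃ hC₄ (Y := fun u => (γ (u + p), deriv γ (u + p))) (Z := fun u => (γ u, deriv γ u))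
        (a := s₁ - (|t - s₁| + 1)) (b := s₁ + (|t - s₁| + 1)) (t₀ := s₁) ⟨by linarith [abs_nonneg (t - s₁)], by linarith [abs_nonneg (t - s₁)]⟩
        hsol2 (fun u _ => hZ u) hstart
      have ht : t ∈ Ioo (s₁ - (|t - s₁| + 1)) (s₁ + (|t - s₁| + 1)) := by
        constructor <;> linarith [le_abs_self (t - s₁), neg_abs_le (t - s₁)]
      exact congrArg Prod.fst (heqOn ht)
    -- local uniqueness radii along the trace
    have hρ : ∀ t : ℝ, ∃ ρ > 0, ∀ y : EuclideanSpace ℝ (Fin 3), y 2 = 0 → f y = M → dist y (γ t) < ρ → ∃ s ∈ Ioo (t - 1) (t + 1), γ s = y :=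
      fun t => hotSet_subset_curve hf2 hκ hcrit htr one_pos (fun s _ => hγd s) (hγ1.continuous.continuousAt) (fun s _ => hplane s)
        (fun s _ => hhot s) (hu2 t) (hunit t) (hker t)
    choose ρ hρ0 hρin using hρ
    refine hiso (range γ) ?_ (range_nonempty γ) (by rintro y ⟨t, rfl⟩; exact ⟨hplane t, hhot t⟩) (⋃ t, ball (γ t) (ρ t))
      (isOpen_iUnion fun t => isOpen_ball) (by rintro y ⟨t, rfl⟩; exact mem_iUnion.2 ⟨t, mem_ball_self (hρ0 t)⟩) ?_
    · rw [← hper.image_Icc hp0 0]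
      exact (isCompact_Icc.image hγ2.continuous)
    · intro y hy hy2 hyM
      obtain ⟨t, ht⟩ := mem_iUnion.1 hy
      obtain ⟨s, -, hs⟩ := hρin t y hy2 hyM (mem_ball.1 ht)
      exact ⟨s, hs⟩
  · -- ## reversed case: `γ(s₁ + s₂ − t) = γ(t)`, absurd at the midpoint
    obtain ⟨hrev2, hrevd⟩ := reverse_facts hγ2 (s₁ + s₂)
    have hrevunit : ∀ t, ‖deriv (fun t => γ (s₁ + s₂ - t)) t‖ = 1 := fun t => by rw [hrevd, norm_neg, hunit]
    have hZr := hasDerivAt_goodCurve hfa hκ hcrit htr hrev2 (fun t => hplane _) (fun t => hhot _) hrevunit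
    have hstart : (γ (s₁ + s₂ - s₁), deriv (fun t => γ (s₁ + s₂ - t)) s₁) = (γ s₁, deriv γ s₁) := by
      rw [hrevd, show s₁ + s₂ - s₁ = s₂ by ring, ← heq, hopp, neg_neg]
    set m := (s₁ + s₂) / 2 with hm
    have hR : ∀ R : ℝ, 0 < R → m ∈ Ioo (s₁ - R) (s₁ + R) →
        (γ (s₁ + s₂ - m), deriv (fun t => γ (s₁ + s₂ - t)) m) = (γ m, deriv γ m) := fun R hR hmR =>
      eqOn_of_solutions (κ := κ) hf4 hC₂ hC₃ hC₄ (t₀ := s₁) ⟨by linarith, by linarith⟩ (fun u _ => hZr u) (fun u _ => hZ u) hstart hmR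
    have h := hR (|m - s₁| + 1) (by positivity) (by constructor <;> linarith [le_abs_self (m - s₁), neg_abs_le (m - s₁)])
    have h2 := congrArg Prod.snd h
    simp only [hrevd] at h2
    rw [show s₁ + s₂ - m = m by rw [hm]; ring] at h2
    have h0 : deriv γ m = 0 := by
      have : (2 : ℝ) • deriv γ m = 0 := by rw [two_smul]; nth_rewrite 1 [← h2]; simp
      exact (smul_eq_zero.1 this).resolve_left two_ne_zero
    have := hunit m
    rw [h0, norm_zero] at this
    exact zero_ne_one this

/-- **A complete non-degenerate hot branch is PROPER at `+∞`.**  See the module docstring. -/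
theorem tendsto_norm_goodCurve_atTop (hfa : AnalyticOnNhd ℝ f univ) {C₂ C₃ C₄ : ℝ}
    (hC₂ : ∀ x, ‖iteratedFDeriv ℝ 2 f x‖ ≤ C₂) (hC₃ : ∀ x, ‖iteratedFDeriv ℝ 3 f x‖ ≤ C₃) (hC₄ : ∀ x, ‖iteratedFDeriv ℝ 4 f x‖ ≤ C₄)
    (hκ : κ ≠ 0)
    (hcrit : ∀ y : EuclideanSpace ℝ (Fin 3), y 2 = 0 → f y = M → fderiv ℝ f y = 0)
    (htr : ∀ y : EuclideanSpace ℝ (Fin 3), y 2 = 0 → f y = M → fderiv ℝ (fderiv ℝ f) y e0 e0 + fderiv ℝ (fderiv ℝ f) y e1 e1 = -κ)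
    (hni : ∀ y : EuclideanSpace ℝ (Fin 3), y 2 = 0 → f y = M → ∀ r > 0,
      ∃ y' : EuclideanSpace ℝ (Fin 3), y' 2 = 0 ∧ f y' = M ∧ y' ≠ y ∧ dist y' y < r)
    (hiso : ∀ K : Set (EuclideanSpace ℝ (Fin 3)), IsCompact K → K.Nonempty → (∀ y ∈ K, y 2 = 0 ∧ f y = M) →
      ∀ O : Set (EuclideanSpace ℝ (Fin 3)), IsOpen O → K ⊆ O → (∀ y ∈ O, y 2 = 0 → f y = M → y ∈ K) → False)
    {γ : ℝ → EuclideanSpace ℝ (Fin 3)} (hγ2 : ContDiff ℝ 2 γ) (hplane : ∀ s, γ s 2 = 0) (hhot : ∀ s, f (γ s) = M)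
    (hunit : ∀ s, ‖deriv γ s‖ = 1) : Tendsto (fun s => ‖γ s‖) atTop atTop := by
  have hf : ContDiff ℝ ω f := contDiff_iff_contDiffAt.2 fun x => (hfa x (mem_univ x)).contDiffAt
  have hf2 : ContDiff ℝ 2 f := hf.of_le le_top
  have hf4 : ContDiff ℝ 4 f := hf.of_le le_top
  have hγd : ∀ t, HasDerivAt γ (deriv γ t) t := fun t => ((hγ2.differentiable (by norm_num)) t).hasDerivAt
  have hγ1 : ContDiff ℝ 1 (deriv γ) := by
    have h2 := hγ2; rw [show (2 : WithTop ℕ∞) = 1 + 1 by norm_num, contDiff_succ_iff_deriv] at h2; exact h2.2.2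
  have hu2 : ∀ t, deriv γ t 2 = 0 := fun t => deriv_apply_two_eq_zero (hγd t) hplane
  have hker : ∀ t w, fderiv ℝ (fderiv ℝ f) (γ t) (deriv γ t) w = 0 := fun t w => hessian_apply_deriv_eq_zero_of_hot hf2 hcrit (hγd t) hplane hhot w
  have hZ := hasDerivAt_goodCurve hfa hκ hcrit htr hγ2 hplane hhot hunit
  have hinj := goodCurve_injective hfa hC₂ hC₃ hC₄ hκ hcrit htr hiso hγ2 hplane hhot hunit
  rw [tendsto_atTop_atTop]
  by_contra H
  push Not at H
  obtain ⟨R, hR⟩ := H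
  -- a sequence `s k → ∞` with `‖γ (s k)‖ < R`, gaps ≥ 1
  choose τ hτge hτR using hR
  let s : ℕ → ℝ := fun k => Nat.rec (τ 0) (fun _ prev => τ (prev + 1)) k
  have hs_succ : ∀ k, s (k + 1) = τ (s k + 1) := fun k => rfl
  have hsR : ∀ k, ‖γ (s k)‖ < R := by
    intro k; cases k with
    | zero => exact hτR 0
    | succ k => rw [hs_succ]; exact hτR _
  have hsgap : ∀ k, s k + 1 ≤ s (k + 1) := fun k => by rw [hs_succ]; exact hτge _
  have hsmono : ∀ k k', k ≤ k' → s k + (k' - k : ℕ) ≤ s k' := by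
    intro k k' hkk'
    induction k' with
    | zero => simp [Nat.le_zero.1 hkk']
    | succ n ih =>
      rcases Nat.of_le_succ hkk' with h | h
      · have := ih h
        rw [Nat.succ_sub h]; push_cast; linarith [hsgap n]
      · subst h; simp
  -- compactness: a convergent subsequence of `(γ (s k), γ′ (s k))`
  have hmem : ∀ k, (γ (s k), deriv γ (s k)) ∈ closedBall (0 : EuclideanSpace ℝ (Fin 3)) R ×ˢ sphere (0 : EuclideanSpace ℝ (Fin 3)) 1 := fun k =>
    ⟨mem_closedBall_zero_iff.2 (hsR k).le, mem_sphere_zero_iff_norm.2 (hunit _)⟩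
  obtain ⟨⟨q, e⟩, ⟨hq, he⟩, φ, hφ, hlim⟩ := ((isCompact_closedBall _ _).prod (isCompact_sphere _ _)).tendsto_subseq hmem
  have hlim1 : Tendsto (fun k => γ (s (φ k))) atTop (𝓝 q) := (continuous_fst.tendsto _).comp hlim
  have hlim2 : Tendsto (fun k => deriv γ (s (φ k))) atTop (𝓝 e) := (continuous_snd.tendsto _).comp hlim
  -- `(q, e)` is a good state
  have hc2 : Continuous fun x : EuclideanSpace ℝ (Fin 3) => x 2 := (EuclideanSpace.proj (2 : Fin 3)).continuous
  have hq2 : q 2 = 0 :=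
    tendsto_nhds_unique ((hc2.tendsto q).comp hlim1) (by simp only [Function.comp_def, hplane]; exact tendsto_const_nhds)
  have hqM : f q = M :=
    tendsto_nhds_unique ((hf.continuous.tendsto q).comp hlim1) (by simp only [Function.comp_def, hhot]; exact tendsto_const_nhds)
  have he2 : e 2 = 0 :=
    tendsto_nhds_unique ((hc2.tendsto e).comp hlim2) (by simp only [Function.comp_def, hu2]; exact tendsto_const_nhds)
  have he1 : ‖e‖ = 1 := by simpa using he
  have hkerq : ∀ w, fderiv ℝ (fderiv ℝ f) q e w = 0 := by
    have hD2c : Continuous fun p : EuclideanSpace ℝ (Fin 3) × EuclideanSpace ℝ (Fin 3) => fderiv ℝ (fderiv ℝ f) p.1 p.2 := by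
      have h1 : Continuous (fderiv ℝ (fderiv ℝ f)) := (hf.fderiv_right (m := 1) le_top).continuous_fderiv one_ne_zero
      exact (h1.comp continuous_fst).clm_apply continuous_snd
    have ht := (hD2c.tendsto (q, e)).comp hlim
    have h0 : (fun k => fderiv ℝ (fderiv ℝ f) (γ (s (φ k))) (deriv γ (s (φ k)))) = fun _ => (0 : EuclideanSpace ℝ (Fin 3) →L[ℝ] ℝ) := by
      funext k; ext w; rw [hker, zero_apply]
    have ht' : Tendsto (fun k => fderiv ℝ (fderiv ℝ f) (γ (s (φ k))) (deriv γ (s (φ k)))) atTop (𝓝 (fderiv ℝ (fderiv ℝ f) q e)) := ht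
    rw [h0] at ht'
    have := tendsto_nhds_unique ht' tendsto_const_nhds
    intro w; rw [this, zero_apply]
  -- the local good solution through `(q, e)` and its uniqueness neighbourhood
  obtain ⟨ε₀, hε₀, Zq, hZq0, hZq⟩ := exists_local_good_solution hfa hκ hcrit htr hni hq2 hqM he2 he1 hkerq 0
  have hZqd1 : ∀ t ∈ Ioo (0 - ε₀) (0 + ε₀), HasDerivAt (fun t => (Zq t).1) ((Zq t).2) t := fun t ht => by
    have h := (hZq t ht).1.hasFDerivAt.fst.hasDerivAt
    refine h.congr_deriv ?_
    simp [branchField, clip_of_norm_eq_one (hZq t ht).2.2.2.2.1]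
  have hderivZq : ∀ t ∈ Ioo (0 - ε₀) (0 + ε₀), deriv (fun t => (Zq t).1) t = (Zq t).2 := fun t ht => (hZqd1 t ht).deriv
  have hZqc : ContinuousAt (deriv fun t => (Zq t).1) 0 := by
    have hI : Ioo (0 - ε₀) (0 + ε₀) ∈ 𝓝 (0 : ℝ) := Ioo_mem_nhds (by linarith) (by linarith)
    have heq : (deriv fun t => (Zq t).1) =ᶠ[𝓝 0] fun t => (Zq t).2 := Filter.eventually_of_mem hI hderivZq
    refine (ContinuousAt.congr ?_ heq.symm)
    exact ((hZq 0 (by simpa using hε₀)).1.continuousAt).snd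
  obtain ⟨ρ, hρ0, hρin⟩ := hotSet_subset_curve (γ := fun t => (Zq t).1) hf2 hκ hcrit htr hε₀
    (fun t ht => by rw [hderivZq t ht]; exact hZqd1 t ht) hZqc (fun t ht => (hZq t ht).2.1) (fun t ht => (hZq t ht).2.2.1)
    (by rw [hderivZq 0 (by simpa using hε₀), hZq0]; exact he2) (by rw [hderivZq 0 (by simpa using hε₀), hZq0]; exact he1)
    (fun w => by rw [hderivZq 0 (by simpa using hε₀), hZq0]; exact hkerq w)
  rw [hZq0] at hρin
  -- every visit of `γ` near `q` is a visit OF `q`, at a time shifted by less than `ε₀`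
  have hvisit : ∀ k, dist (γ (s (φ k))) q < ρ → ∃ σ : ℝ, |σ| < ε₀ ∧ γ (s (φ k) + σ) = q := by
    intro k hk
    obtain ⟨t, ht, hty⟩ := hρin (γ (s (φ k))) (hplane _) (hhot _) hk
    have ht1 : -ε₀ < t := by have := ht.1; linarith
    have ht2 : t < ε₀ := by have := ht.2; linarith
    have ht' : |t| < ε₀ := abs_lt.2 ⟨ht1, ht2⟩
    obtain ⟨-, -, -, hZ2two, hZ2one, hZ2ker⟩ := hZq t ht
    -- the tangent of `γ` at `s (φ k)` is `±` the ODE direction at `t`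
    have hdir := kernel_dir_eq_or_eq_neg (B := fderiv ℝ (fderiv ℝ f) (Zq t).1) hκ hZ2two hZ2one (hu2 (s (φ k))) (hunit (s (φ k)))
      hZ2ker (fun w => by rw [hty]; exact hker _ w) (htr _ (hZq t ht).2.1 (hZq t ht).2.2.1)
    -- the shifted local solution `u ↦ Zq (t + u)` on `Ioo (−ε₀ − t) (ε₀ − t) ∋ 0, −t`
    have hsolq : ∀ u ∈ Ioo (-ε₀ - t) (ε₀ - t), HasDerivAt (fun u => Zq (t + u)) (branchField f κ (Zq (t + u))) u := fun u hu => by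
      have h := (hZq (t + u) ⟨by linarith [hu.1], by linarith [hu.2]⟩).1
      exact h.comp_const_add t u
    have hI0 : (0 : ℝ) ∈ Ioo (-ε₀ - t) (ε₀ - t) := ⟨by linarith, by linarith⟩
    have hIt : -t ∈ Ioo (-ε₀ - t) (ε₀ - t) := ⟨by linarith, by linarith⟩
    rcases hdir with hsame | hopp
    · -- forward: `γ (s + u) = (Zq (t + u)).1`
      have hsolγ : ∀ u ∈ Ioo (-ε₀ - t) (ε₀ - t), HasDerivAt (fun u => (γ (s (φ k) + u), deriv γ (s (φ k) + u)))
          (branchField f κ (γ (s (φ k) + u), deriv γ (s (φ k) + u))) u := fun u _ => (hZ (s (φ k) + u)).comp_const_add (s (φ k)) u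
      have h0 : (γ (s (φ k) + 0), deriv γ (s (φ k) + 0)) = Zq (t + 0) := by
        rw [add_zero, add_zero]; exact Prod.ext hty.symm hsame
      have heq := eqOn_of_solutions (κ := κ) hf4 hC₂ hC₃ hC₄ hI0 hsolγ hsolq h0 hIt
      refine ⟨-t, by rw [abs_neg]; exact ht', ?_⟩
      have := congrArg Prod.fst heq
      simpa [hZq0] using this
    · -- backward: `γ (s − u) = (Zq (t + u)).1`
      obtain ⟨hrev2, hrevd⟩ := reverse_facts hγ2 (s (φ k))
      have hrevunit : ∀ u, ‖deriv (fun u => γ (s (φ k) - u)) u‖ = 1 := fun u => by rw [hrevd, norm_neg, hunit]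
      have hZr := hasDerivAt_goodCurve hfa hκ hcrit htr hrev2 (fun u => hplane _) (fun u => hhot _) hrevunit
      have h0 : (γ (s (φ k) - 0), deriv (fun u => γ (s (φ k) - u)) 0) = Zq (t + 0) := by
        rw [hrevd, sub_zero, add_zero]; exact Prod.ext hty.symm (by rw [hopp, neg_neg])
      have heq := eqOn_of_solutions (κ := κ) hf4 hC₂ hC₃ hC₄ hI0 (fun u _ => hZr u) hsolq h0 hIt
      refine ⟨t, ht', ?_⟩
      have := congrArg Prod.fst heq
      simpa [hZq0] using this
  -- two far-apart visits of `q` contradict injectivity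
  have hnear : ∀ᶠ k in atTop, dist (γ (s (φ k))) q < ρ := (hlim1.eventually (ball_mem_nhds q hρ0)).mono fun k hk => mem_ball.1 hk
  obtain ⟨k₁, hk₁⟩ := hnear.exists
  obtain ⟨N, hN⟩ : ∃ N : ℕ, 2 * ε₀ < N := exists_nat_gt _
  have hnear' : ∀ᶠ k in atTop, dist (γ (s (φ k))) q < ρ ∧ φ k₁ + N + 1 ≤ φ k :=
    hnear.and ((hφ.tendsto_atTop.eventually (eventually_ge_atTop (φ k₁ + N + 1))))
  obtain ⟨k₂, hk₂, hk₂far⟩ := hnear'.exists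
  obtain ⟨σ₁, hσ₁, h₁⟩ := hvisit k₁ hk₁
  obtain ⟨σ₂, hσ₂, h₂⟩ := hvisit k₂ hk₂
  have heqs : s (φ k₁) + σ₁ = s (φ k₂) + σ₂ := hinj (h₁.trans h₂.symm)
  have hfar : s (φ k₁) + ((φ k₂ - φ k₁ : ℕ) : ℝ) ≤ s (φ k₂) := hsmono _ _ (by omega)
  have hNN : (N : ℝ) + 1 ≤ ((φ k₂ - φ k₁ : ℕ) : ℝ) := by
    have : φ k₁ + N + 1 ≤ φ k₂ := hk₂far
    exact_mod_cast (by omega : N + 1 ≤ φ k₂ - φ k₁)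
  have := abs_lt.1 hσ₁; have := abs_lt.1 hσ₂
  linarith

/-- **… and PROPER at `−∞`.** -/
theorem tendsto_norm_goodCurve_atBot (hfa : AnalyticOnNhd ℝ f univ) {C₂ C₃ C₄ : ℝ}
    (hC₂ : ∀ x, ‖iteratedFDeriv ℝ 2 f x‖ ≤ C₂) (hC₃ : ∀ x, ‖iteratedFDeriv ℝ 3 f x‖ ≤ C₃) (hC₄ : ∀ x, ‖iteratedFDeriv ℝ 4 f x‖ ≤ C₄)
    (hκ : κ ≠ 0)
    (hcrit : ∀ y : EuclideanSpace ℝ (Fin 3), y 2 = 0 → f y = M → fderiv ℝ f y = 0)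
    (htr : ∀ y : EuclideanSpace ℝ (Fin 3), y 2 = 0 → f y = M → fderiv ℝ (fderiv ℝ f) y e0 e0 + fderiv ℝ (fderiv ℝ f) y e1 e1 = -κ)
    (hni : ∀ y : EuclideanSpace ℝ (Fin 3), y 2 = 0 → f y = M → ∀ r > 0,
      ∃ y' : EuclideanSpace ℝ (Fin 3), y' 2 = 0 ∧ f y' = M ∧ y' ≠ y ∧ dist y' y < r)
    (hiso : ∀ K : Set (EuclideanSpace ℝ (Fin 3)), IsCompact K → K.Nonempty → (∀ y ∈ K, y 2 = 0 ∧ f y = M) →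
      ∀ O : Set (EuclideanSpace ℝ (Fin 3)), IsOpen O → K ⊆ O → (∀ y ∈ O, y 2 = 0 → f y = M → y ∈ K) → False)
    {γ : ℝ → EuclideanSpace ℝ (Fin 3)} (hγ2 : ContDiff ℝ 2 γ) (hplane : ∀ s, γ s 2 = 0) (hhot : ∀ s, f (γ s) = M)
    (hunit : ∀ s, ‖deriv γ s‖ = 1) : Tendsto (fun s => ‖γ s‖) atBot atTop := by
  obtain ⟨hrev2, hrevd⟩ := reverse_facts hγ2 0
  have hrevunit : ∀ u, ‖deriv (fun u => γ (0 - u)) u‖ = 1 := fun u => by rw [hrevd, norm_neg, hunit]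
  have h := tendsto_norm_goodCurve_atTop hfa hC₂ hC₃ hC₄ hκ hcrit htr hni hiso hrev2 (fun u => hplane _) (fun u => hhot _) hrevunit
  have h2 := h.comp tendsto_neg_atBot_atTop
  simpa [Function.comp_def] using h2

end Summit.NavierStokesRegularity.NavierStokesRegularity.Theorems.PoloidalWindowDoorLrcModEntireRidgeGlobalBranchProper

end
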